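import Mathlib.Data.Fin.VecNotation
import Literature.MathematicalPhysics.QuantumFieldTheory.KanekoUeda2010.DominantConeNormalForm
import HarnessLib

/-!
# Kaneko–Ueda 2010 §3, COMPUTABLE FORM: a finite certificate, checkable by `decide`, for the stated bound of a quotient `P / Π_k F_k^{a_k}` times a monomial weight on a simplicial cone chart — PROVED (soundness = `abs_eval_div_prod_pow_mul_monom_le` + list bookkeeping)

independent recomputation; certified where stated, statistical where stated; no new-physics claim.

CITATION HEADER (venture `QEDPrecision`, cell `qed-hepp` (HOME `run/shared/lean/pub/qed-hepp/`), engine seat `qed-hepp-eng-1` gen 3, 2026-08-25;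
VALUE-FREE: statements about ABSTRACT multivariate polynomials given as explicit term lists — no Feynman graph, no sector table, no Monte-Carlo
value, nothing per word or per Set-V family). Companion of `DominantConeNormalForm.lean` (p402490). WHY THIS FILE EXISTS: p402490's bounded-summand
theorem `abs_eval_div_prod_pow_mul_monom_le` is stated over Mathlib's `MvPolynomial`, whose supports and coefficients are NOT kernel-computable, so no
concrete instance («this polynomial data, this cone, these exponents») can ever be discharged by `decide` against it directly. Here the same
statement is given a COMPUTABLE front end: polynomials as term lists `CPoly N = List ((Fin N → ℕ) × ℚ)`, denominators as records `Denom N` (term list,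
natural power, chosen support monomial with its listed coefficient), a DECIDABLE predicate `LeafCheck P D v w` that checks exactly the printed
hypotheses (positive listed denominator coefficients; the chosen monomial is listed; the per-generator exponent inequality
`Σ_k a_k (b_k, v_l) ≤ min_{listed c} (c, v_l) + w_l`, i.e. BND's «E_l ≥ 0»), and the SOUNDNESS theorem `abs_evalR_div_prod_pow_mul_monom_le_of_leafCheck`:
`LeafCheck` ⇒ on `(0,1]^M`, `|P(t(z))| / Π_k F_k(t(z))^{a_k} · Π_l z_l^{w_l} ≤ ‖P‖₁ / Π_k c_k^{a_k}` — p402490's conclusion with the listed ℓ¹ norm and the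
listed coefficients (a weaker-or-equal constant: duplicate exponents in a list may only merge). A toy instance is discharged by `decide` at the end
(`leafCheck_example`). Cell sheet `HOME/qed-hepp-eng-1/BND-TYPING.md` §4 T1 (the blueprint this serves).

Source [KanekoUeda2010]: T. Kaneko, T. Ueda, "A geometric method of sector decomposition", Comput. Phys. Commun. 181 (2010) 1352–1361 =
arXiv:0908.2897, §3 eq. (geo:glz) and the paragraph after it [chunk p7:L63–L110], VERBATIM (as in the companion): "t_j = e^{−y_j} = e^{−(Vu)_j} =
Π_k z_k^{(v_k)_j} … we can take vectors {v_j} on the integer lattice v_j ∈ ℤ^{N−1}_{≥0}∖{0}. Since (c−b, y) ≥ 0 for all y ∈ Δ_b^P and (c−b) ∈ ℤ^{N−1},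
(c−b, v_j) is non-negative integer. Thus the sub-expressions in the brackets of Eq. (geo:glz) are polynomials of z." and §3 [p6:L50–L56]: "(b, u) =
min{(c, u) | c ∈ Z^P}" — the certificate's `minList` is this minimum over the LISTED exponents, a lower bound of the companion's `minPair` over the true
support.

TYPING. `CPoly N := List ((Fin N → ℕ) × ℚ)` (exponent vector, rational coefficient; duplicates and zero coefficients allowed — they only weaken the
constant); `CPoly.evalR p x = Σ_{(e,c) ∈ p} c · Π_j x_j^{e_j}` (real evaluation), `CPoly.l1 p = Σ |c|`, `CPoly.toMv p = Σ monomial e c` (the bridge,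
noncomputable, used only in proofs); `Denom N` = ⟨poly, pow, dom, coef⟩; the pairing `(c, v_l)` is `CPoly.idot (v l) c = Σ_j (v l)_j c_j` on `Fin N → ℕ` (Mathlib's `dotProduct`, spelled out);
`coneChart`, `ipair`, `minPair`, `sumAbsCoeff` are the companion's / `Borinsky2020.TropicalApproximation`'s.

PROVED (0 named facts, D-0026): bridge lemmas `CPoly.eval_toMv` (`MvPolynomial.eval x p.toMv = p.evalR x`), `CPoly.coeff_toMv` (coefficient = sum of the
listed coefficients at that exponent), `CPoly.exists_mem_of_mem_support_toMv` (support ⊆ listed exponents), `sumAbsCoeff_add_le`, `sumAbsCoeff_monomial_le`,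
`CPoly.sumAbsCoeff_toMv_le_l1`, `ipair_equivFunOnFinite_symm` (`ipair w ⟨e⟩ = idot w e`), `CPoly.minList_le_minPair_toMv`, `CPoly.coeff_toMv_nonneg`,
`CPoly.le_coeff_toMv_of_mem`; the decidable `LeafCheck` with its `Decidable` instance; **`abs_evalR_div_prod_pow_mul_monom_le_of_leafCheck`** (soundness);
`leafCheck_example` (a two-variable toy discharged by `decide`, showing the checker evaluates in the kernel).
NOT typed (as in the companion): the Jacobian `|det V|`, the assembly of leaves into a simplex integral, fan completeness; anything per graph. A per-word
use is: emit `P`, `D`, the leaves `(v, w)` as literals (reviewed definitions), prove `LeafCheck` per leaf by `decide`, conclude the stated bound by this theorem.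
-/

open MvPolynomial Finset Real

namespace Literature.MathematicalPhysics.QuantumFieldTheory.KanekoUeda2010

open Borinsky2020

variable {N M : ℕ}

/-! ### Computable polynomial data -/

/-- A polynomial in `N` variables as an explicit TERM LIST: pairs (exponent vector, rational coefficient). Duplicated exponents and zero
coefficients are allowed (they merge/vanish in `toMv` and can only weaken the certificate's constant).
[cite: KanekoUeda2010, §3 "P(t) = Σ_{c ∈ Z^P} a_c t^c" (chunk p6:L40–L50)] -/
abbrev CPoly (N : ℕ) : Type := List ((Fin N → ℕ) × ℚ)

namespace CPoly

/-- Real evaluation of a term list: `Σ_{(e,c)} c · Π_j x_j^{e_j}`. [cite: KanekoUeda2010, §3 (chunk p6:L40–L50)] -/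
noncomputable def evalR (p : CPoly N) (x : Fin N → ℝ) : ℝ := (p.map fun t => (t.2 : ℝ) * ∏ j, x j ^ t.1 j).sum

/-- The listed ℓ¹ norm `Σ |c|` (≥ the companion's `sumAbsCoeff` of the merged polynomial). [cite: KanekoUeda2010, §3 (chunk p6:L40–L50)] -/
def l1 (p : CPoly N) : ℚ := (p.map fun t => |t.2|).sum

/-- The bridge to Mathlib: the `MvPolynomial` `Σ_{(e,c)} monomial e c` (noncomputable; proofs only). [cite: KanekoUeda2010, §3 (chunk p6:L40–L50)] -/
noncomputable def toMv (p : CPoly N) : MvPolynomial (Fin N) ℝ :=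
  (p.map fun t => monomial (Finsupp.equivFunOnFinite.symm t.1) (t.2 : ℝ)).sum

/-- The pairing `(c, w) = Σ_j w_j c_j` of an exponent vector with a weight/generator, on function-backed vectors (computable; = Mathlib's
`dotProduct`, spelled out to keep the certificate's kernel evaluation elementary). [cite: KanekoUeda2010, §3 "(c, v_k)" (chunk p6:L50–L56, p7:L100–L104)] -/
def idot (w e : Fin N → ℕ) : ℕ := ∑ j, w j * e j

/-- Minimum of a list of naturals (junk `0` on the empty list, which only makes a certificate harder to pass).
[cite: KanekoUeda2010, §3 "(b, u) = min{(c, u) | c ∈ Z^P}" (chunk p6:L50–L56)] -/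
def minList : List ℕ → ℕ
  | [] => 0
  | [a] => a
  | a :: b :: l => min a (minList (b :: l))

/-- The empty term list is the zero polynomial. Plumbing. [cite: KanekoUeda2010, §3 (chunk p6:L40–L50)] -/
@[simp] theorem toMv_nil : toMv ([] : CPoly N) = 0 := rfl

/-- `toMv` of a cons is the head monomial plus `toMv` of the tail. Plumbing. [cite: KanekoUeda2010, §3 (chunk p6:L40–L50)] -/
theorem toMv_cons (t : (Fin N → ℕ) × ℚ) (p : CPoly N) :
    toMv (t :: p) = monomial (Finsupp.equivFunOnFinite.symm t.1) (t.2 : ℝ) + toMv p := by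
  simp [toMv]

/-- The empty term list evaluates to `0`. Plumbing. [cite: KanekoUeda2010, §3 (chunk p6:L40–L50)] -/
@[simp] theorem evalR_nil (x : Fin N → ℝ) : evalR ([] : CPoly N) x = 0 := rfl

/-- Evaluation of a cons: head term plus tail. Plumbing. [cite: KanekoUeda2010, §3 (chunk p6:L40–L50)] -/
theorem evalR_cons (t : (Fin N → ℕ) × ℚ) (p : CPoly N) (x : Fin N → ℝ) :
    evalR (t :: p) x = (t.2 : ℝ) * (∏ j, x j ^ t.1 j) + evalR p x := by
  simp [evalR]

/-- `‖[]‖₁ = 0`. Plumbing. [cite: KanekoUeda2010, §3 (chunk p6:L40–L50)] -/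
@[simp] theorem l1_nil : l1 ([] : CPoly N) = 0 := rfl

/-- `‖t :: p‖₁ = |c_t| + ‖p‖₁`. Plumbing. [cite: KanekoUeda2010, §3 (chunk p6:L40–L50)] -/
theorem l1_cons (t : (Fin N → ℕ) × ℚ) (p : CPoly N) : l1 (t :: p) = |t.2| + l1 p := by
  simp [l1]

/-- `minList l ≤ a` for every member `a`. [cite: KanekoUeda2010, §3 (chunk p6:L50–L56)] -/
theorem minList_le_of_mem : ∀ {l : List ℕ} {a : ℕ}, a ∈ l → minList l ≤ a
  | [], _, h => by simp at h
  | [b], a, h => by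
      simp only [List.mem_singleton] at h
      subst h; simp [minList]
  | b :: c :: l, a, h => by
      rw [minList]
      rcases List.mem_cons.mp h with rfl | h'
      · exact min_le_left _ _
      · exact (min_le_right _ _).trans (minList_le_of_mem h')

/-- **Bridge, evaluation**: the `MvPolynomial` of a term list evaluates to the list evaluation. [cite: KanekoUeda2010, §3 (chunk p6:L40–L50)] -/
theorem eval_toMv (p : CPoly N) (x : Fin N → ℝ) : MvPolynomial.eval x p.toMv = p.evalR x := by
  induction p with
  | nil => simp
  | cons t p ih =>
      rw [toMv_cons, evalR_cons, map_add, ih, eval_monomial,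
        Finsupp.prod_fintype _ _ (fun i => by simp)]
      simp

/-- **Bridge, coefficients**: the coefficient of `toMv p` at `d` is the sum of the listed coefficients whose exponent vector is `d`.
[cite: KanekoUeda2010, §3 (chunk p6:L40–L50)] -/
theorem coeff_toMv (p : CPoly N) (d : Fin N →₀ ℕ) :
    coeff d p.toMv = ((p.filter fun t => Finsupp.equivFunOnFinite.symm t.1 = d).map fun t => (t.2 : ℝ)).sum := by
  classical
  induction p with
  | nil => simp
  | cons t p ih =>
      rw [toMv_cons, coeff_add, coeff_monomial, ih, List.filter_cons]
      by_cases h : Finsupp.equivFunOnFinite.symm t.1 = d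
      · simp [h]
      · simp [h]

/-- **Bridge, support**: every support exponent of `toMv p` is a listed exponent. [cite: KanekoUeda2010, §3 (chunk p6:L40–L50)] -/
theorem exists_mem_of_mem_support_toMv (p : CPoly N) {d : Fin N →₀ ℕ} (hd : d ∈ p.toMv.support) :
    ∃ t ∈ p, Finsupp.equivFunOnFinite.symm t.1 = d := by
  classical
  rw [mem_support_iff, coeff_toMv] at hd
  by_contra hne
  push Not at hne
  apply hd
  have : (p.filter fun t => Finsupp.equivFunOnFinite.symm t.1 = d) = [] := by
    rw [List.filter_eq_nil_iff]
    intro t ht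
    simpa using hne t ht
  rw [this]; simp

end CPoly

/-! ### `sumAbsCoeff` is subadditive; the listed ℓ¹ norm dominates it -/

/-- Summing `|coeff|` over any finite set gives at most `sumAbsCoeff` (terms outside the support vanish). Plumbing.
[cite: KanekoUeda2010, §3 (chunk p6:L40–L50)] -/
theorem sum_abs_coeff_le_sumAbsCoeff (p : MvPolynomial (Fin N) ℝ) (S : Finset (Fin N →₀ ℕ)) :
    ∑ d ∈ S, |p.coeff d| ≤ sumAbsCoeff p := by
  classical
  have h : ∑ d ∈ S ∩ p.support, |p.coeff d| = ∑ d ∈ S, |p.coeff d| :=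
    Finset.sum_subset Finset.inter_subset_left fun d hdS hdn => by
      have hds : d ∉ p.support := fun hds => hdn (Finset.mem_inter.mpr ⟨hdS, hds⟩)
      rw [notMem_support_iff] at hds
      simp [hds]
  rw [← h, sumAbsCoeff]
  exact Finset.sum_le_sum_of_subset_of_nonneg Finset.inter_subset_right (fun _ _ _ => abs_nonneg _)

/-- `sumAbsCoeff (p + q) ≤ sumAbsCoeff p + sumAbsCoeff q`. [cite: KanekoUeda2010, §3 (chunk p6:L40–L50)] -/
theorem sumAbsCoeff_add_le (p q : MvPolynomial (Fin N) ℝ) : sumAbsCoeff (p + q) ≤ sumAbsCoeff p + sumAbsCoeff q := by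
  classical
  unfold sumAbsCoeff
  calc ∑ d ∈ (p + q).support, |(p + q).coeff d|
      ≤ ∑ d ∈ (p + q).support, (|p.coeff d| + |q.coeff d|) :=
        Finset.sum_le_sum fun d _ => by rw [coeff_add]; exact abs_add_le _ _
    _ = (∑ d ∈ (p + q).support, |p.coeff d|) + ∑ d ∈ (p + q).support, |q.coeff d| := Finset.sum_add_distrib
    _ ≤ sumAbsCoeff p + sumAbsCoeff q :=
        add_le_add (sum_abs_coeff_le_sumAbsCoeff p _) (sum_abs_coeff_le_sumAbsCoeff q _)

/-- `sumAbsCoeff (monomial e a) ≤ |a|`. [cite: KanekoUeda2010, §3 (chunk p6:L40–L50)] -/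
theorem sumAbsCoeff_monomial_le (e : Fin N →₀ ℕ) (a : ℝ) : sumAbsCoeff (monomial e a : MvPolynomial (Fin N) ℝ) ≤ |a| := by
  classical
  unfold sumAbsCoeff
  calc ∑ d ∈ (monomial e a).support, |(monomial e a).coeff d|
      ≤ ∑ d ∈ {e}, |(monomial e a : MvPolynomial (Fin N) ℝ).coeff d| :=
        Finset.sum_le_sum_of_subset_of_nonneg support_monomial_subset (fun _ _ _ => abs_nonneg _)
    _ = |a| := by simp [coeff_monomial]

/-- **The listed ℓ¹ norm dominates `sumAbsCoeff` of the merged polynomial.** [cite: KanekoUeda2010, §3 (chunk p6:L40–L50)] -/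
theorem CPoly.sumAbsCoeff_toMv_le_l1 (p : CPoly N) : sumAbsCoeff p.toMv ≤ (p.l1 : ℝ) := by
  induction p with
  | nil => simp [sumAbsCoeff]
  | cons t p ih =>
      rw [CPoly.toMv_cons, CPoly.l1_cons, Rat.cast_add, Rat.cast_abs]
      exact (sumAbsCoeff_add_le _ _).trans (add_le_add (sumAbsCoeff_monomial_le _ _) ih)

/-! ### The pairing and the valuation on listed data -/

/-- The companion's pairing on a function-backed exponent vector is the function-backed `idot`: `ipair w ⟨e⟩ = Σ_j w_j e_j`.
[cite: KanekoUeda2010, §3 "(c, v_k) = Σ_j c_j (v_k)_j" (chunk p6:L50–L56, p7:L100–L104)] -/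
theorem ipair_equivFunOnFinite_symm (w e : Fin N → ℕ) : ipair w (Finsupp.equivFunOnFinite.symm e) = CPoly.idot w e := by
  classical
  unfold ipair CPoly.idot
  rw [Finset.sum_subset (Finset.subset_univ _)]
  · simp
  · intro j _ hj
    rw [Finsupp.notMem_support_iff] at hj
    simp [hj]

/-- **The listed minimum is a lower bound of the true valuation**: if `toMv p ≠ 0` then
`minList [(c, w) | (c, ·) ∈ p] ≤ minPair (toMv p) w`. [cite: KanekoUeda2010, §3 "(b, u) = min{(c, u) | c ∈ Z^P}" (chunk p6:L50–L56)] -/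
theorem CPoly.minList_le_minPair_toMv (p : CPoly N) (w : Fin N → ℕ) (hp : p.toMv ≠ 0) :
    CPoly.minList (p.map fun t => CPoly.idot w t.1) ≤ minPair p.toMv w := by
  have hne : p.toMv.support.Nonempty := support_nonempty.mpr hp
  simp only [minPair, hne, ↓reduceDIte]
  refine (Finset.le_inf'_iff hne _).2 fun d hd => ?_
  obtain ⟨t, ht, rfl⟩ := p.exists_mem_of_mem_support_toMv hd
  rw [ipair_equivFunOnFinite_symm]
  exact CPoly.minList_le_of_mem (List.mem_map.mpr ⟨t, ht, rfl⟩)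

/-- Positive listed coefficients ⇒ every true coefficient is non-negative. [cite: KanekoUeda2010, §2 "C_a z^{b_a}(1 + H_a(z))" with positive coefficients (chunk p4:L152–L176)] -/
theorem CPoly.coeff_toMv_nonneg (F : CPoly N) (hF : ∀ t ∈ F, 0 < t.2) (d : Fin N →₀ ℕ) : 0 ≤ coeff d F.toMv := by
  rw [CPoly.coeff_toMv]
  refine List.sum_nonneg fun x hx => ?_
  obtain ⟨t, ht, rfl⟩ := List.mem_map.mp hx
  exact_mod_cast (hF t (List.mem_of_mem_filter ht)).le

/-- Positive listed coefficients ⇒ the true coefficient at a LISTED term is at least that term's coefficient.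
[cite: KanekoUeda2010, §2 (chunk p4:L152–L176)] -/
theorem CPoly.le_coeff_toMv_of_mem (F : CPoly N) (hF : ∀ t ∈ F, 0 < t.2) {e : Fin N → ℕ} {c : ℚ} (h : (e, c) ∈ F) :
    (c : ℝ) ≤ coeff (Finsupp.equivFunOnFinite.symm e) F.toMv := by
  rw [CPoly.coeff_toMv]
  refine List.single_le_sum (fun x hx => ?_) _ ?_
  · obtain ⟨t, ht, rfl⟩ := List.mem_map.mp hx
    exact_mod_cast (hF t (List.mem_of_mem_filter ht)).le
  · exact List.mem_map.mpr ⟨(e, c), List.mem_filter.mpr ⟨h, by simp⟩, rfl⟩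

/-! ### Denominator records, the decidable certificate, soundness -/

/-- A denominator factor of the certificate: its term list, its natural power `a_k`, a chosen support monomial `b_k` and that monomial's LISTED
coefficient `c_k` (the sharpest choice is the dominant monomial of the cone; any listed one is sound).
[cite: KanekoUeda2010, §3 eq. (geo:glz) (chunk p7:L63–L110)] -/
structure Denom (N : ℕ) : Type where
  /-- the factor's term list -/
  poly : CPoly N
  /-- its power `a_k ∈ ℕ` -/
  pow : ℕ
  /-- the chosen support monomial `b_k` -/
  dom : Fin N → ℕ
  /-- the listed coefficient of `b_k` -/
  coef : ℚ

/-- **The certificate predicate** for numerator `P`, denominators `D`, cone generators `v` and monomial weight `w`: (i) every listed denominator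
coefficient is positive; (ii) each chosen monomial is listed with the recorded coefficient, which is positive; (iii) at every generator `l`,
`Σ_k a_k (b_k, v_l) ≤ min_{listed c of P} (c, v_l) + w_l` (BND «E_l ≥ 0»). Decidable on literals (`decide`).
[cite: KanekoUeda2010, §3 eq. (geo:glz) and the paragraph after it (chunk p7:L63–L110)] -/
def LeafCheck (P : CPoly N) (D : List (Denom N)) (v : Fin M → Fin N → ℕ) (w : Fin M → ℕ) : Prop :=
  (∀ d ∈ D, ∀ t ∈ d.poly, 0 < t.2) ∧
  (∀ d ∈ D, (d.dom, d.coef) ∈ d.poly ∧ 0 < d.coef) ∧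
  (∀ l : Fin M, (∑ k : Fin D.length, (D.get k).pow * CPoly.idot (v l) (D.get k).dom) ≤
      CPoly.minList (P.map fun t => CPoly.idot (v l) t.1) + w l)

/-- `LeafCheck` is decidable (finite conjunction of `ℕ`/`ℚ` comparisons over lists), so concrete certificates are discharged by `decide`.
[cite: KanekoUeda2010, §3 eq. (geo:glz) (chunk p7:L63–L110)] -/
instance (P : CPoly N) (D : List (Denom N)) (v : Fin M → Fin N → ℕ) (w : Fin M → ℕ) : Decidable (LeafCheck P D v w) := by
  unfold LeafCheck; infer_instance

/-- **SOUNDNESS of the certificate = Kaneko–Ueda's stated bound on listed data.** If `LeafCheck P D v w` holds then on the half-open cube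
`0 < z ≤ 1`: `|P(t(z))| / Π_k F_k(t(z))^{a_k} · Π_l z_l^{w_l} ≤ ‖P‖₁ / Π_k c_k^{a_k}`, where `t = coneChart v z`, `F_k`, `a_k`, `c_k` are the
denominator records' polynomials, powers and listed coefficients. Proof: bridge to `MvPolynomial` and apply the companion's
`abs_eval_div_prod_pow_mul_monom_le` (p402490) with the chosen monomials `b_k`; then `sumAbsCoeff ≤ ‖P‖₁` and `coeff b_k ≥ c_k > 0`.
[cite: KanekoUeda2010, §3 eq. (geo:glz) and the paragraph after it (chunk p7:L63–L110)] -/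
theorem abs_evalR_div_prod_pow_mul_monom_le_of_leafCheck (P : CPoly N) (D : List (Denom N)) (v : Fin M → Fin N → ℕ) (w : Fin M → ℕ)
    (h : LeafCheck P D v w) {z : Fin M → ℝ} (hz0 : ∀ l, 0 < z l) (hz1 : ∀ l, z l ≤ 1) :
    |P.evalR (coneChart v z)| / (∏ k : Fin D.length, (D.get k).poly.evalR (coneChart v z) ^ (D.get k).pow) * ∏ l, z l ^ w l ≤
      (P.l1 : ℝ) / ∏ k : Fin D.length, ((D.get k).coef : ℝ) ^ (D.get k).pow := by
  obtain ⟨hpos, hdom, hE⟩ := h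
  -- constants
  have hl1 : 0 ≤ (P.l1 : ℝ) := by
    have : (0 : ℚ) ≤ P.l1 := List.sum_nonneg fun x hx => by
      obtain ⟨t, _, rfl⟩ := List.mem_map.mp hx; exact abs_nonneg _
    exact_mod_cast this
  have hck : ∀ k : Fin D.length, 0 < ((D.get k).coef : ℝ) := fun k => by
    exact_mod_cast (hdom _ (List.get_mem D k)).2
  have hCpos : 0 < ∏ k : Fin D.length, ((D.get k).coef : ℝ) ^ (D.get k).pow := Finset.prod_pos fun k _ => pow_pos (hck k) _
  have hRHS : 0 ≤ (P.l1 : ℝ) / ∏ k : Fin D.length, ((D.get k).coef : ℝ) ^ (D.get k).pow := div_nonneg hl1 hCpos.le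
  -- the MvPolynomial data
  set F : Fin D.length → MvPolynomial (Fin N) ℝ := fun k => (D.get k).poly.toMv with hFdef
  set a : Fin D.length → ℕ := fun k => (D.get k).pow with hadef
  set b : Fin D.length → (Fin N →₀ ℕ) := fun k => Finsupp.equivFunOnFinite.symm (D.get k).dom with hbdef
  have hFpos : ∀ k, ∀ c ∈ (F k).support, 0 ≤ (F k).coeff c := fun k c _ =>
    CPoly.coeff_toMv_nonneg _ (hpos _ (List.get_mem D k)) c
  have hcb : ∀ k, ((D.get k).coef : ℝ) ≤ (F k).coeff (b k) := fun k =>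
    CPoly.le_coeff_toMv_of_mem _ (hpos _ (List.get_mem D k)) (hdom _ (List.get_mem D k)).1
  have hc : ∀ k, 0 < (F k).coeff (b k) := fun k => (hck k).trans_le (hcb k)
  have hb : ∀ k, b k ∈ (F k).support := fun k => mem_support_iff.mpr (hc k).ne'
  -- evaluations agree
  have hevP : |P.evalR (coneChart v z)| = |MvPolynomial.eval (coneChart v z) P.toMv| := by rw [CPoly.eval_toMv]
  have hevF : (∏ k : Fin D.length, (D.get k).poly.evalR (coneChart v z) ^ (D.get k).pow) =
      ∏ k, MvPolynomial.eval (coneChart v z) (F k) ^ a k := by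
    refine Finset.prod_congr rfl fun k _ => ?_
    rw [hFdef]; dsimp only; rw [CPoly.eval_toMv]
  rw [hevP, hevF]
  by_cases hP : P.toMv = 0
  · -- trivial case: the numerator is the zero polynomial
    rw [hP, map_zero, abs_zero, zero_div, zero_mul]
    exact hRHS
  -- exponent hypothesis of the companion
  have hE' : ∀ l, ∑ k, a k * ipair (v l) (b k) ≤ minPair P.toMv (v l) + w l := by
    intro l
    have h1 := hE l
    have h2 := CPoly.minList_le_minPair_toMv P (v l) hP
    have h3 : ∑ k, a k * ipair (v l) (b k) = ∑ k : Fin D.length, (D.get k).pow * CPoly.idot (v l) (D.get k).dom := by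
      refine Finset.sum_congr rfl fun k _ => ?_
      rw [hbdef]; dsimp only; rw [ipair_equivFunOnFinite_symm]
    rw [h3]; omega
  have main := abs_eval_div_prod_pow_mul_monom_le P.toMv F a hFpos b hb hc v w hE' hz0 hz1
  refine main.trans ?_
  -- compare the constants
  have hCpos' : 0 < ∏ k, (F k).coeff (b k) ^ a k := Finset.prod_pos fun k _ => pow_pos (hc k) _
  have hprod_le : (∏ k : Fin D.length, ((D.get k).coef : ℝ) ^ (D.get k).pow) ≤ ∏ k, (F k).coeff (b k) ^ a k :=
    Finset.prod_le_prod (fun k _ => pow_nonneg (hck k).le _) fun k _ => pow_le_pow_left₀ (hck k).le (hcb k) _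
  exact div_le_div₀ hl1 (CPoly.sumAbsCoeff_toMv_le_l1 P) hCpos hprod_le

/-! ### A toy instance discharged by `decide` (shows the checker evaluates in the kernel; value-free) -/

/-- Toy numerator in two variables: `P = 3·x₀²x₁ − 5·x₀x₁³`. [cite: KanekoUeda2010, §3 (chunk p6:L40–L56)] -/
def toyP : CPoly 2 := [(![2, 1], 3), (![1, 3], -5)]

/-- Toy denominator `F = 2·x₀ + x₁²` to the power 1, chosen monomial `x₀` with listed coefficient 2. [cite: KanekoUeda2010, §3 (chunk p7:L63–L110)] -/
def toyD : List (Denom 2) := [⟨[(![1, 0], 2), (![0, 2], 1)], 1, ![1, 0], 2⟩]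

/-- Toy cone generators `v₀ = (1,0)`, `v₁ = (1,1)` and weight `w = (0,0)`: at `v₀` the numerator valuation is `min(2,1) = 1 ≥ 1·(b,v₀) = 1`; at `v₁`
`min(3,4) = 3 ≥ 1`. [cite: KanekoUeda2010, §3 (chunk p7:L63–L110)] -/
theorem leafCheck_example : LeafCheck toyP toyD ![![1, 0], ![1, 1]] ![0, 0] := by decide

/-- Hence, on `(0,1]²`, `|P(t(z))| / F(t(z)) ≤ ‖P‖₁ / 2 = 4` for the toy data — an instance of the soundness theorem.
[cite: KanekoUeda2010, §3 (chunk p7:L63–L110)] -/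
theorem toy_bound {z : Fin 2 → ℝ} (hz0 : ∀ l, 0 < z l) (hz1 : ∀ l, z l ≤ 1) :
    |toyP.evalR (coneChart ![![1, 0], ![1, 1]] z)| /
        (∏ k : Fin toyD.length, (toyD.get k).poly.evalR (coneChart ![![1, 0], ![1, 1]] z) ^ (toyD.get k).pow) * ∏ l, z l ^ (![0, 0] : Fin 2 → ℕ) l ≤
      (toyP.l1 : ℝ) / ∏ k : Fin toyD.length, ((toyD.get k).coef : ℝ) ^ (toyD.get k).pow :=
  abs_evalR_div_prod_pow_mul_monom_le_of_leafCheck toyP toyD _ _ leafCheck_example hz0 hz1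

end Literature.MathematicalPhysics.QuantumFieldTheory.KanekoUeda2010
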